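import Literature.Computability.FineGrained.NegativeTriangleToRadiusProgram
import Literature.Computability.Cryptography.RadiusGadgetGraph
import HarnessLib

/-!
# Negative Triangle `≤₃` Radius (Abboud–Grandoni–Vassilevska Williams 2015, Lemma 2.3): the verified reduction

Abboud, Grandoni and Vassilevska Williams, *Subcubic equivalences between graph centrality problems,
APSP and diameter*, SODA 2015, Thm. 1.1: Radius (of a weighted graph) and APSP are equivalent under
subcubic reductions; "one direction is trivial, and the other is given by Lemmas 2.1 and 2.3" —
Lemma 2.1 being APSP `≤₃` Negative Triangle (Vassilevska Williams–Williams 2010/2018, in this library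
`APSP_fgReducible_negativeTriangle_holds`) and Lemma 2.3 the gadget reduction Negative Triangle `≤₃`
Radius. This file proves the latter as a fine-grained reduction in the word-RAM model of the prelude
(`FGReducible`, VVW ICM 2018, Def. 2.1):

**`negativeTriangle_fgReducible_radius_same c : FGReducible (NegativeTriangle c) (n ↦ n³)
(Radius (c + 2)) (n ↦ n³)`**, by assembling

* the verified oracle program `NegTriToRadius.prog c` and its semantics `prog_spec`
  (`Literature.Computability.FineGrained.NegativeTriangleToRadiusProgram`),
* the dense radius gadget `radiusGadget W Q` and its radius criterion
  `weightedRadius_radiusGadget_eq_iff` (`Literature.Computability.Cryptography.RadiusGadgetGraph`),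
* the encoding estimates of `SubcubicEquivalencesAPSP` and the budget lemmas of
  `NegativeTriangleToAPSP`.

Also proved here: `Radius_isStandard` (the zoo problem `Radius c` is well formed for the budget `n³`,
the hypothesis under which fine-grained reductions compose and transfer running times in the model).

## The steps

1. `valF_eq`: the cell values written by the program are the codes of the gadget's entries
   (`recode` re-encodes `⌜W u v⌝` as `⌜Q + W u v⌝`), so the query is *literally*
   `encodeMatrixWithTop (radiusGadget W Q)` (`qseg_eq`), `Q = 2 nᶜ + 2`;
2. `radiusGadget_mem_Radius`: that graph on `4 n + 1` vertices is a `Radius (c + 2)` instance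
   (weights `≤ 3Q = 6 nᶜ + 6 ≤ (4 n + 1)^{c+2}`, nonnegative hence no negative cycle), so an oracle
   answering `Radius (c + 2)` returns `[⌜R⌝]`, `R` the radius, and `⌜R⌝ = 6Q - 1 = ⌜3Q - 1⌝` iff
   `R = 3Q - 1` iff `W` has a negative triangle (`weightedRadius_radiusGadget_eq_iff` with `M = nᶜ`,
   `2M + 1 ≤ Q`): the output `[1]/[0]` is the accepted one;
3. budgets: word size `(c + 8) · width` (`pTop_lt_capacity`, `wQ_lt_capacity`,
   `answer_lt_capacity`); for `ε > 0` take `δ = min ε (1/3)` and `C = 126 + c`: time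
   `34 n² + 19 n + 46 + c`, one query of size `4 n + 1` with ledger `((4n+1)³)^{1-ε} ≤ 125 (n³)^{1-δ} + 1`
   (`ledger_le_five`) and length `(4 n + 1)² + 1`.

Everything here is proved; the reduction is deterministic, as in print.

## References

* A. Abboud, F. Grandoni, V. Vassilevska Williams, *Subcubic equivalences between graph centrality
  problems, APSP and diameter*, Proc. SODA 2015, 1681–1697: Thm. 1.1, Lemma 2.3.
  doi:10.1137/1.9781611973730.112
* V. Vassilevska Williams, *On some fine-grained questions in algorithms and complexity*, Proc. ICM
  2018, §2, Def. 2.1 (fine-grained reductions on the word RAM).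
-/

namespace Literature.Computability.FineGrained

namespace NegTriToRadius

open Cryptography Cryptography.WordRAM Cryptography.WordRAM.SProg Matrix NegTriToAPSP

/-! ### The cells are the codes of the gadget -/

section Identify

variable {n : ℕ} (W : Matrix (Fin n) (Fin n) ℤ) {Q M : ℕ}

/-- The code `⌜2Q⌝ = 4Q + 1`. [folklore] -/
theorem encode_twoQ (Q : ℕ) : encodeWithTopInt ((2 * (Q : ℤ) : ℤ) : WithTop ℤ) = 4 * Q + 1 := by
  rw [show (2 * (Q : ℤ) : ℤ) = ((2 * Q : ℕ) : ℤ) by push_cast; ring, encodeWithTopInt_natCast']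
  ring

/-- The code `⌜3Q - 1⌝ = 6Q - 1` (`Q ≥ 1`). [folklore] -/
theorem encode_threeQ {Q : ℕ} (hQ : 1 ≤ Q) :
    encodeWithTopInt ((3 * (Q : ℤ) - 1 : ℤ) : WithTop ℤ) = 6 * Q - 1 := by
  rw [show (3 * (Q : ℤ) - 1 : ℤ) = ((3 * Q - 1 : ℕ) : ℤ) by omega, encodeWithTopInt_natCast']
  omega

/-- The input code at the row-major offset `U n + V` is the code of `W U V`. [folklore] -/
theorem code_mk {U V : ℕ} (hU : U < n) (hV : V < n) :
    code W (U * n + V) = encodeWithTopInt ((W ⟨U, hU⟩ ⟨V, hV⟩ : ℤ) : WithTop ℤ) := by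
  have ht : U * n + V < n * n := mul_add_lt_mul hU hV
  rw [code, dif_pos ht]
  have e1 : Fin.divNat ⟨U * n + V, ht⟩ = ⟨U, hU⟩ := divNat_mk_mul_add ⟨U, hU⟩ ⟨V, hV⟩ ht
  have e2 : Fin.modNat ⟨U * n + V, ht⟩ = ⟨V, hV⟩ := modNat_mk_mul_add ⟨U, hU⟩ ⟨V, hV⟩ ht
  rw [e1, e2]

/-- **The recoded input code is the code of the shifted weight**: `recode Q ⌜W U V⌝ = ⌜Q + W U V⌝`
for `|W| ≤ M`, `M + 1 ≤ Q`. [folklore] -/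
theorem recode_code (hW : ∀ a b, |W a b| ≤ M) (hQ : M + 1 ≤ Q) {U V : ℕ} (hU : U < n) (hV : V < n) :
    recode Q (code W (U * n + V)) = encodeWithTopInt ((((Q : ℤ) + wx W U V) : ℤ) : WithTop ℤ) := by
  rw [code_mk W hU hV, recode_encode (hW _ _) hQ, wx_mk W hU hV]

/-- **The final cell values are the codes of the gadget's entries.** [folklore] -/
theorem valF_eq (hW : ∀ a b, |W a b| ≤ M) (hQ : M + 1 ≤ Q) (U V : ℕ) :
    valF W Q U V = encodeWithTopInt (radiusGadgetEntry W Q U V) := by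
  have hQ1 : 1 ≤ Q := by omega
  unfold valF radiusGadgetEntry
  by_cases hU1 : U < n
  · rw [if_pos hU1, if_pos hU1]
    by_cases hV1 : V < n
    · rw [if_pos hV1, if_pos hV1]
      split_ifs
      · rfl
      · rw [encode_twoQ]
    rw [if_neg hV1, if_neg hV1]
    by_cases hV2 : V < 2 * n
    · rw [if_pos hV2, if_pos hV2]
      split_ifs
      · rw [encode_twoQ]
      · rw [show U * n + (V - n) = U * n + (V - n) from rfl, recode_code W hW hQ hU1 (by omega)]
    rw [if_neg hV2, if_neg hV2]
    by_cases hV3 : V < 3 * n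
    · rw [if_pos hV3, if_pos hV3]; rfl
    rw [if_neg hV3, if_neg hV3]
    by_cases hV4 : V < 4 * n
    · rw [if_pos hV4, if_pos hV4]
      split_ifs
      · rfl
      · rw [encode_twoQ]
    · rw [if_neg hV4, if_neg hV4, encode_threeQ hQ1]
  rw [if_neg hU1, if_neg hU1]
  by_cases hU2 : U < 2 * n
  · rw [if_pos hU2, if_pos hU2]
    split_ifs with h
    · rw [recode_code W hW hQ (by omega) (by omega)]
    · rfl
  rw [if_neg hU2, if_neg hU2]
  by_cases hU3 : U < 3 * n
  · rw [if_pos hU3, if_pos hU3]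
    split_ifs with h
    · rw [recode_code W hW hQ (by omega) (by omega)]
    · rfl
  · rw [if_neg hU3, if_neg hU3]; rfl

/-- **The query is the gadget**: the segment handed to the Radius oracle is exactly
`encodeMatrixWithTop (radiusGadget W Q)`. [folklore] -/
theorem qseg_eq (hW : ∀ a b, |W a b| ≤ M) (hQ : M + 1 ≤ Q) :
    qseg W Q = encodeMatrixWithTop (radiusGadget W Q) := by
  rw [qseg, encodeMatrixWithTop_eq_cons_ofFn]
  refine congrArg _ (congrArg List.ofFn (funext fun m => ?_))
  rw [radiusGadget_apply, Fin.coe_divNat, Fin.coe_modNat, valF_eq W hW hQ]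

end Identify

/-! ### The Radius instance and the answer -/

section Instance

variable {n : ℕ} (W : Matrix (Fin n) (Fin n) ℤ)

/-- `2 nᶜ + 1 ≤ Q = wQ n c`. [folklore] -/
theorem two_mul_pow_succ_le_wQ (n c : ℕ) : 2 * n ^ c + 1 ≤ wQ n c := by unfold wQ; omega

/-- **The gadget of a `NegativeTriangle c` instance is a `Radius (c + 2)` instance** (`4 n + 1`
vertices): weights `≤ 3Q = 6 nᶜ + 6 ≤ (4 n + 1)^{c+2}` (for `n = 0` the single vertex `y` has no arc),
no negative cycle. [folklore] -/
theorem radiusGadget_mem_Radius (c : ℕ) (hW : ∀ a b, |W a b| ≤ n ^ c) :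
    HasBoundedWeights (radiusGadget W (wQ n c)) ((4 * n + 1) ^ (c + 2)) ∧
      HasNoNegativeCycle (radiusGadget W (wQ n c)) := by
  have hQ := two_mul_pow_succ_le_wQ n c
  refine ⟨?_, hasNoNegativeCycle_radiusGadget hW hQ⟩
  rcases Nat.eq_zero_or_pos n with hn | hn
  · subst hn
    intro u v
    left
    rw [radiusGadget_apply]
    unfold radiusGadgetEntry
    rw [if_neg (by omega), if_neg (by omega), if_neg (by omega)]
  · refine hasBoundedWeights_mono (hasBoundedWeights_radiusGadget hW hQ) ?_
    have h1 : n ^ c ≤ (4 * n + 1) ^ c := Nat.pow_le_pow_left (by omega) c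
    have h2 : 1 ≤ n ^ c := Nat.one_le_pow _ _ hn
    have h3 : 25 ≤ (4 * n + 1) ^ 2 := by nlinarith
    calc 3 * wQ n c = 6 * n ^ c + 6 := by unfold wQ; ring
      _ ≤ 25 * n ^ c := by omega
      _ ≤ (4 * n + 1) ^ 2 * (4 * n + 1) ^ c := Nat.mul_le_mul h3 h1
      _ = (4 * n + 1) ^ (c + 2) := by ring

/-- The gadget as an instance of `Radius (c + 2)` (size `4 n + 1`). [folklore] -/
def gadgetInst (c : ℕ) (hW : ∀ a b, |W a b| ≤ n ^ c) : (Radius (c + 2)).Inst :=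
  ⟨⟨4 * n, radiusGadget W (wQ n c)⟩, radiusGadget_mem_Radius W c hW⟩

/-- The weighted radius of a graph with `M`-bounded distances is an `M`-bounded weight (it is `⊤` or
an eccentricity, hence a distance). [folklore] -/
theorem isBddWeight_weightedRadius {ι : Type*} [Fintype ι] [DecidableEq ι] [Nonempty ι]
    {G : Matrix ι ι (WithTop ℤ)} {M : ℕ} (h : HasBoundedWeights (shortestDist G) M) :
    IsBddWeight M (weightedRadius G) := by
  unfold weightedRadius
  refine IsBddWeight.finset_inf _ fun i _ => ?_
  unfold weightedEccentricity
  obtain ⟨j, -, hj⟩ := Finset.exists_mem_eq_sup' (Finset.univ_nonempty (α := ι))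
    (fun j => shortestDist G i j)
  rw [hj]
  exact h i j

/-- **The answer word**: the code of the radius of the gadget is at most
`2 · ((4 n + 1) · 3Q) + 1`. [folklore] -/
theorem answer_le (c : ℕ) (hW : ∀ a b, |W a b| ≤ n ^ c) :
    encodeWithTopInt (weightedRadius (radiusGadget W (wQ n c))) ≤ 2 * ((4 * n + 1) * (3 * wQ n c)) + 1 := by
  have hQ := two_mul_pow_succ_le_wQ n c
  have hd := hasBoundedWeights_shortestDist (hasBoundedWeights_radiusGadget hW hQ)
  rw [Fintype.card_fin] at hd
  exact encodeWithTopInt_le_of_isBddWeight (isBddWeight_weightedRadius hd)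

/-- **The test of the program is the negative-triangle predicate**: the radius code equals
`6Q - 1 = ⌜3Q - 1⌝` iff `W` has a negative triangle (AGV Lemma 2.3: "output YES … if and only if
`R* ≤ 3Q - 1`"; here `R* ≥ 3Q - 1` always). [cite: AbboudGrandoniVassilevskaWilliams2015, Lemma 2.3 (proof of Thm. 1.1)] -/
theorem answer_eq_iff (c : ℕ) (hW : ∀ a b, |W a b| ≤ n ^ c) :
    encodeWithTopInt (weightedRadius (radiusGadget W (wQ n c))) = 6 * wQ n c - 1 ↔
      HasNegativeTriangle W := by
  have hQ := two_mul_pow_succ_le_wQ n c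
  rw [← weightedRadius_radiusGadget_eq_iff hW hQ, ← encode_threeQ (Q := wQ n c) (by omega)]
  exact ⟨fun h => encodeWithTopInt_injective h, fun h => by rw [h]⟩

/-- All input codes of a `NegativeTriangle c` instance are `≤ 2 nᶜ + 1 ≤ 2Q`. [folklore] -/
theorem code_le_two_mul_wQ (c : ℕ) (hW : ∀ a b, |W a b| ≤ n ^ c) (t : ℕ) : code W t ≤ 2 * wQ n c := by
  by_cases ht : t < n * n
  · rw [code, dif_pos ht]
    refine le_trans (encodeWithTopInt_coe_le _) ?_
    have := hW (Fin.divNat ⟨t, ht⟩) (Fin.modNat ⟨t, ht⟩)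
    have habs : ((W (Fin.divNat ⟨t, ht⟩) (Fin.modNat ⟨t, ht⟩)).natAbs : ℤ) ≤ n ^ c := by
      rwa [Int.natCast_natAbs]
    have habs' : (W (Fin.divNat ⟨t, ht⟩) (Fin.modNat ⟨t, ht⟩)).natAbs ≤ n ^ c := by exact_mod_cast habs
    unfold wQ; omega
  · rw [code_of_le W (not_lt.1 ht)]; exact Nat.zero_le _

end Instance

/-! ### Capacity of the word size; the budgets -/

/-- All addresses fit: `pTop n < (n² + 2)⁸ ≤ (n² + 2)^{c+8}`. [folklore] -/
theorem pTop_lt_capacity (n c : ℕ) : pTop n < (n * n + 1 + 1) ^ (c + 8) := by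
  set X := n * n + 1 + 1 with hX
  have hX2 : 2 ≤ X := by omega
  have hnX : n ≤ X := by rw [hX]; nlinarith
  have h1 : pTop n < 128 * X := by unfold pTop; omega
  have h2 : 128 * X ≤ X ^ (c + 8) := by
    calc 128 * X = 2 ^ 7 * X := by norm_num
      _ ≤ X ^ 7 * X := Nat.mul_le_mul_right _ (Nat.pow_le_pow_left hX2 7)
      _ = X ^ 8 := by ring
      _ ≤ X ^ (c + 8) := Nat.pow_le_pow_right (by omega) (by omega)
  omega

/-- The weight parameter fits: `8 Q = 16 nᶜ + 16 < (n² + 2)^{c+8}`. [folklore] -/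
theorem wQ_lt_capacity (n c : ℕ) : 8 * wQ n c < (n * n + 1 + 1) ^ (c + 8) := by
  set X := n * n + 1 + 1 with hX
  have hX2 : 2 ≤ X := by omega
  have hnX : n ≤ X := by rw [hX]; nlinarith
  have hc : n ^ c ≤ X ^ c := Nat.pow_le_pow_left hnX c
  have h1 : 1 ≤ X ^ c := Nat.one_le_pow _ _ (by omega)
  calc 8 * wQ n c = 16 * n ^ c + 16 := by unfold wQ; ring
    _ ≤ 32 * X ^ c := by omega
    _ < X ^ 8 * X ^ c := Nat.mul_lt_mul_of_pos_right
        (lt_of_lt_of_le (by norm_num : 32 < 2 ^ 8) (Nat.pow_le_pow_left hX2 8)) (by omega)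
    _ = X ^ (c + 8) := by ring

/-- The answer word fits: `2 · ((4n + 1) · 3Q) + 1 < (n² + 2)^{c+8}`. [folklore] -/
theorem answer_lt_capacity (n c : ℕ) : 2 * ((4 * n + 1) * (3 * wQ n c)) + 1 < (n * n + 1 + 1) ^ (c + 8) := by
  set X := n * n + 1 + 1 with hX
  have hX2 : 2 ≤ X := by omega
  have hnX : n ≤ X := by rw [hX]; nlinarith
  have hc : n ^ c ≤ X ^ c := Nat.pow_le_pow_left hnX c
  have h1 : 1 ≤ X ^ c := Nat.one_le_pow _ _ (by omega)
  have hQ : wQ n c ≤ 4 * X ^ c := by have : wQ n c = 2 * n ^ c + 2 := rfl; omega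
  have hN : 4 * n + 1 ≤ 4 * X := by have := Nat.le_mul_self n; omega
  have h2 : 2 * ((4 * n + 1) * (3 * wQ n c)) + 1 ≤ 97 * (X * X ^ c) := by
    have := Nat.mul_le_mul hN (Nat.mul_le_mul_left 3 hQ)
    nlinarith
  calc 2 * ((4 * n + 1) * (3 * wQ n c)) + 1 ≤ 97 * (X * X ^ c) := h2
    _ < X ^ 7 * (X * X ^ c) := Nat.mul_lt_mul_of_pos_right
        (lt_of_lt_of_le (by norm_num : 97 < 2 ^ 7) (Nat.pow_le_pow_left hX2 7))
        (Nat.mul_pos (by omega) (by omega))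
    _ = X ^ (c + 8) := by ring

/-- The ledger estimate for the single query of size `4 n + 1`:
`((4n + 1)³)^{1-ε} ≤ 125 (n³)^{1-δ} + 1` whenever `0 ≤ ε` and `δ ≤ ε`. [folklore] -/
theorem ledger_le_five {ε δ : ℝ} (hε : 0 ≤ ε) (hδε : δ ≤ ε) (n : ℕ) :
    (((4 * n + 1 : ℕ) : ℝ) ^ (3 : ℝ)) ^ (1 - ε) ≤ 125 * ((n : ℝ) ^ (3 : ℝ)) ^ (1 - δ) + 1 := by
  have h0 : (0 : ℝ) ≤ ((n : ℝ) ^ (3 : ℝ)) ^ (1 - δ) :=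
    Real.rpow_nonneg (Real.rpow_nonneg (Nat.cast_nonneg _) _) _
  have hb1 : (1 : ℝ) ≤ ((4 * n + 1 : ℕ) : ℝ) ^ (3 : ℝ) :=
    Real.one_le_rpow (by exact_mod_cast (show 1 ≤ 4 * n + 1 by omega)) (by norm_num)
  rcases le_or_gt ε 1 with hε1 | hε1
  · -- `1 - ε ≥ 0`: monotone in the base, `(4n+1)³ ≤ 125 n³` for `n ≥ 1`
    rcases Nat.eq_zero_or_pos n with rfl | hn
    · have e : (((4 * 0 + 1 : ℕ) : ℝ) ^ (3 : ℝ)) = 1 := by norm_num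
      rw [e, Real.one_rpow]
      linarith [h0]
    · have hn1 : (1 : ℝ) ≤ n := by exact_mod_cast hn
      have ha : (1 : ℝ) ≤ (n : ℝ) ^ (3 : ℝ) := Real.one_le_rpow hn1 (by norm_num)
      have ha0 : (0 : ℝ) ≤ (n : ℝ) ^ (3 : ℝ) := le_trans zero_le_one ha
      have hle : ((4 * n + 1 : ℕ) : ℝ) ≤ 5 * n := by
        have : 4 * n + 1 ≤ 5 * n := by omega
        exact_mod_cast this
      have h5 : ((4 * n + 1 : ℕ) : ℝ) ^ (3 : ℝ) ≤ 125 * (n : ℝ) ^ (3 : ℝ) := by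
        calc ((4 * n + 1 : ℕ) : ℝ) ^ (3 : ℝ) ≤ (5 * (n : ℝ)) ^ (3 : ℝ) :=
              Real.rpow_le_rpow (Nat.cast_nonneg _) hle (by norm_num)
          _ = 125 * (n : ℝ) ^ (3 : ℝ) := by
              rw [Real.mul_rpow (by norm_num) (Nat.cast_nonneg n)]
              congr 1
              rw [show (3 : ℝ) = ((3 : ℕ) : ℝ) by norm_num, Real.rpow_natCast]
              norm_num
      calc (((4 * n + 1 : ℕ) : ℝ) ^ (3 : ℝ)) ^ (1 - ε) ≤ (125 * (n : ℝ) ^ (3 : ℝ)) ^ (1 - ε) :=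
            Real.rpow_le_rpow (le_trans zero_le_one hb1) h5 (by linarith)
        _ = (125 : ℝ) ^ (1 - ε) * ((n : ℝ) ^ (3 : ℝ)) ^ (1 - ε) := Real.mul_rpow (by norm_num) ha0
        _ ≤ 125 * ((n : ℝ) ^ (3 : ℝ)) ^ (1 - δ) := by
            have h1 : (125 : ℝ) ^ (1 - ε) ≤ 125 := by
              conv_rhs => rw [← Real.rpow_one 125]
              exact Real.rpow_le_rpow_of_exponent_le (by norm_num) (by linarith)
            have h2 : ((n : ℝ) ^ (3 : ℝ)) ^ (1 - ε) ≤ ((n : ℝ) ^ (3 : ℝ)) ^ (1 - δ) :=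
              Real.rpow_le_rpow_of_exponent_le ha (by linarith)
            have h3 : (0 : ℝ) ≤ ((n : ℝ) ^ (3 : ℝ)) ^ (1 - ε) := Real.rpow_nonneg ha0 _
            exact mul_le_mul h1 h2 h3 (by norm_num)
        _ ≤ 125 * ((n : ℝ) ^ (3 : ℝ)) ^ (1 - δ) + 1 := by linarith
  · -- `1 - ε < 0`: a base `≥ 1` to a nonpositive power is `≤ 1`
    have : (((4 * n + 1 : ℕ) : ℝ) ^ (3 : ℝ)) ^ (1 - ε) ≤ 1 :=
      Real.rpow_le_one_of_one_le_of_nonpos hb1 (by linarith)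
    linarith [h0]

/-! ### The reduction -/

/-- **Abboud–Grandoni–Vassilevska Williams 2015, Lemma 2.3 (Negative Triangle `≤₃` Radius), proved
with the weight exponent `c + 2`**: for every `c`, Negative Triangle with weights in `[-nᶜ, nᶜ]`
reduces to Radius of weighted digraphs with weights in `[-N^{c+2}, N^{c+2}]` by the verified word-RAM
program `prog c` — one Radius query on the dense radius gadget (`N = 4 n + 1` vertices), `O(n²)`
time, word size `(c + 8) · width`; for every `ε > 0` the definition of `FGReducible`
(VVW ICM 2018, Def. 2.1) is met with `δ = min ε (1/3)` and `C = 126 + c`. In print the gadget is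
sparse (bit gadget `Z ∪ O`, hub `x`); the dense rendering is this library's
(`Literature.Computability.Cryptography.RadiusGadgetGraph`).
[cite: AbboudGrandoniVassilevskaWilliams2015, Lemma 2.3 (proof of Thm. 1.1)] -/
theorem negativeTriangle_fgReducible_radius_same (c : ℕ) :
    FGReducible (NegativeTriangle c) (fun n => (n : ℝ) ^ (3 : ℝ)) (Radius (c + 2))
      (fun n => (n : ℝ) ^ (3 : ℝ)) := by
  intro ε hε
  refine ⟨min ε (1 / 3), lt_min hε (by norm_num), (prog c).toProgram, c + 8, 126 + c,
    prog_isDeterministic c, ?_⟩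
  intro O hO x
  obtain ⟨⟨n, W⟩, hWb⟩ := x
  change HasBoundedWeights (W.map ((↑) : ℤ → WithTop ℤ)) (n ^ c) at hWb
  have hW : ∀ a b, |W a b| ≤ n ^ c := forall_abs_le_of_hasBoundedWeights_map W hWb
  have hQ := two_mul_pow_succ_le_wQ n c
  have hδ3 : min ε (1 / 3) ≤ 1 / 3 := min_le_right _ _
  have hδε : min ε (1 / 3) ≤ ε := min_le_left _ _
  have hbud0 : (0 : ℝ) ≤ ((n : ℝ) ^ (3 : ℝ)) ^ (1 - min ε (1 / 3)) :=
    Real.rpow_nonneg (Real.rpow_nonneg (Nat.cast_nonneg _) _) _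
  have hsq := sq_le_budget hδ3 n
  have hc0 : (0 : ℝ) ≤ c := Nat.cast_nonneg c
  -- the Radius instance queried
  let y : (Radius (c + 2)).Inst := gadgetInst W c hW
  -- the word size
  set w : ℕ := (c + 8) * inputWidth (inp W) with hw_def
  have hwid : inputWidth (inp W) ≤ w := inputWidth_le_mul (by omega) _
  have hcap : ∀ v, v < (n * n + 1 + 1) ^ (c + 8) → v < 2 ^ w := fun v hv =>
    lt_two_pow_mul_inputWidth (by rw [inp_length]; exact hv)
  have hF : pTop n < 2 ^ w := hcap _ (pTop_lt_capacity n c)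
  have hQw : 8 * wQ n c < 2 ^ w := hcap _ (wQ_lt_capacity n c)
  -- the oracle's answer
  have hans_eq : O (qseg W (wQ n c)) = [encodeWithTopInt (weightedRadius (radiusGadget W (wQ n c)))] := by
    have := hO y
    change O (encodeMatrixWithTop (radiusGadget W (wQ n c))) ∈
      ({[encodeWithTopInt (weightedRadius (radiusGadget W (wQ n c)))]} : Set (List ℕ)) at this
    rw [Set.mem_singleton_iff] at this
    rw [qseg_eq W hW (by omega)]
    exact this
  have hlen : (O (qseg W (wQ n c))).length = 1 := by rw [hans_eq]; rfl
  have hwv : ∀ v ∈ O (qseg W (wQ n c)), v < 2 ^ w := by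
    rw [hans_eq]
    intro v hv
    rw [List.mem_singleton] at hv
    subst hv
    exact hcap _ (lt_of_le_of_lt (answer_le W c hW) (answer_lt_capacity n c))
  obtain ⟨st', ⟨t, ht, hex⟩, hqs, hM0, hM1⟩ :=
    prog_spec (O := O) W c hwid hF hQw (code_le_two_mul_wQ W c hW) hlen hwv
  refine ⟨st'.cfg none 0, [y], ?_, ?_, ?_, ?_, ?_⟩
  · -- the run halts within the budget
    refine haltsWithin_toProgram hex (Nat.le_floor ?_) zeroCoins
    change ((t + 1 : ℕ) : ℝ) ≤ (126 + c) * ((n : ℝ) ^ (3 : ℝ)) ^ (1 - min ε (1 / 3)) + (126 + c)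
    have hnn : (n : ℝ) ≤ (n : ℝ) * n := by exact_mod_cast Nat.le_mul_self n
    have ht' : ((t + 1 : ℕ) : ℝ) ≤ 34 * ((n : ℝ) * n) + 19 * n + 46 + c := by
      exact_mod_cast (show t + 1 ≤ 34 * (n * n) + 19 * n + 46 + c by omega)
    nlinarith
  · -- the output is the accepted one
    change readOut st'.mem ∈ (FGProblem.ofPred
      (fun W : Σ n, Matrix (Fin n) (Fin n) ℤ => encodeMatrixWithTop (W.2.map (↑))) (·.1)
      (fun W : Σ n, Matrix (Fin n) (Fin n) ℤ => HasNegativeTriangle W.2)).Good ⟨n, W⟩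
    have hout : readOut st'.mem = [st'.mem 1] := by simp [readOut, readSeg, hM0]
    have hget : (O (qseg W (wQ n c))).getD 0 0 = encodeWithTopInt (weightedRadius (radiusGadget W (wQ n c))) := by
      rw [hans_eq]; rfl
    rw [hout, hM1, hget]
    by_cases h : HasNegativeTriangle W
    · rw [if_pos ((answer_eq_iff W c hW).2 h), FGProblem.ofPred_good_of_pos _ _
        (fun W : Σ n, Matrix (Fin n) (Fin n) ℤ => HasNegativeTriangle W.2) ⟨n, W⟩ h]
      exact Set.mem_singleton _
    · rw [if_neg (fun h' => h ((answer_eq_iff W c hW).1 h')), FGProblem.ofPred_good_of_neg _ _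
        (fun W : Σ n, Matrix (Fin n) (Fin n) ℤ => HasNegativeTriangle W.2) ⟨n, W⟩ h]
      exact Set.mem_singleton _
  · -- the query log lists the encoding of the queried instance
    change st'.queries = [encodeMatrixWithTop (radiusGadget W (wQ n c))]
    rw [hqs, qseg_eq W hW (by omega)]
  · -- the ledger of Def. 2.1
    simp only [List.map_cons, List.map_nil, List.sum_cons, List.sum_nil, add_zero]
    change (((4 * n + 1 : ℕ) : ℝ) ^ (3 : ℝ)) ^ (1 - ε) ≤
      (126 + c) * ((n : ℝ) ^ (3 : ℝ)) ^ (1 - min ε (1 / 3)) + (126 + c)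
    have := ledger_le_five hε.le hδε n
    nlinarith
  · -- the total query length
    simp only [List.map_cons, List.map_nil, List.sum_cons, List.sum_nil, add_zero]
    change (((encodeMatrixWithTop (radiusGadget W (wQ n c))).length : ℕ) : ℝ) ≤
      (126 + c) * ((n : ℝ) ^ (3 : ℝ)) ^ (1 - min ε (1 / 3)) + (126 + c)
    rw [encodeMatrixWithTop_length]
    push_cast
    have hnn : (n : ℝ) ≤ (n : ℝ) * n := by exact_mod_cast Nat.le_mul_self n
    nlinarith

end NegTriToRadius

/-! ### `Radius c` is well formed -/

open Cryptography Cryptography.WordRAM in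
/-- **Radius is well formed for the budget `n ^ 3`** (`FGProblem.IsStandard`): an instance on
`n + 1` vertices has encoding length `(n + 1)² + 1 ≤ ((n + 1)³)^{2/3} + 1`, input width
`≤ (c + 2)(n + 2) ≤ (c + 2)(n + 1)³ + (c + 2)`, and the output (one word, the code of the radius, a
shortest distance or `⊤`, distances lying in `[-(n+1)(n+1)ᶜ, (n+1)(n+1)ᶜ]`) is word-representable
(`< 2 ^ ((c + 3) · width)`). (VVW ICM 2018, §2 conventions, checked for the zoo problem of
Abboud–Grandoni–Vassilevska Williams 2015.) [folklore] -/
theorem Radius_isStandard (c : ℕ) : (Radius c).IsStandard fun n => (n : ℝ) ^ (3 : ℝ) where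
  nonneg n := rpow_three_nonneg n
  length_le := ⟨1, 1 / 3, by norm_num, fun W => by
    change (((encodeMatrixWithTop W.1.2).length : ℕ) : ℝ) ≤
      1 * (((W.1.1 + 1 : ℕ) : ℝ) ^ (3 : ℝ)) ^ (1 - 1 / 3 : ℝ) + 1
    rw [encodeMatrixWithTop_length, rpow_three_rpow_two_thirds]
    push_cast
    nlinarith⟩
  width_le := ⟨c + 2, fun W => by
    change ((inputWidth (encodeMatrixWithTop W.1.2) : ℕ) : ℝ) ≤
      (c + 2 : ℝ) * ((W.1.1 + 1 : ℕ) : ℝ) ^ (3 : ℝ) + (c + 2)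
    have hW : HasBoundedWeights W.1.2 ((W.1.1 + 1) ^ c) ∧ HasNoNegativeCycle W.1.2 := W.2
    exact le_trans (by exact_mod_cast inputWidth_encodeMatrixWithTop_le hW.1)
      (width_bound_le_budget c (W.1.1 + 1))⟩
  hasWordOutputs := by
    refine ⟨c + 3, 1, fun W out hout => ?_⟩
    have hW : HasBoundedWeights W.1.2 ((W.1.1 + 1) ^ c) ∧ HasNoNegativeCycle W.1.2 := W.2
    have hout' : out = [encodeWithTopInt (weightedRadius W.1.2)] := hout
    subst hout'
    change [encodeWithTopInt (weightedRadius W.1.2)].length ≤ 1 * (encodeMatrixWithTop W.1.2).length + 1 ∧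
      ∀ v ∈ [encodeWithTopInt (weightedRadius W.1.2)],
        v < 2 ^ ((c + 3) * inputWidth (encodeMatrixWithTop W.1.2))
    refine ⟨by simp, fun v hv => lt_two_pow_mul_inputWidth ?_⟩
    rw [List.mem_singleton] at hv
    subst hv
    rw [encodeMatrixWithTop_length]
    have hd := hasBoundedWeights_shortestDist hW.1
    rw [Fintype.card_fin] at hd
    refine lt_of_le_of_lt ?_ (max_lt_pow_APSP (W.1.1 + 1) c)
    exact le_trans (encodeWithTopInt_le_of_isBddWeight (NegTriToRadius.isBddWeight_weightedRadius hd))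
      (le_max_right _ _)

open Cryptography in
/-- **AGV 2015, Lemma 2.3 in family form**: for every weight exponent `c` there is `c'` (namely
`c + 2`) and a subcubic fine-grained reduction from Negative Triangle with weights in `[-nᶜ, nᶜ]` to
Radius with weights in `[-N^{c'}, N^{c'}]`. [cite: AbboudGrandoniVassilevskaWilliams2015, Lemma 2.3 (proof of Thm. 1.1)] -/
theorem negativeTriangle_fgReducible_radius (c : ℕ) :
    ∃ c' : ℕ, FGReducible (NegativeTriangle c) (fun n => (n : ℝ) ^ (3 : ℝ)) (Radius c')
      (fun n => (n : ℝ) ^ (3 : ℝ)) :=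
  ⟨c + 2, NegTriToRadius.negativeTriangle_fgReducible_radius_same c⟩

end Literature.Computability.FineGrained
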